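import Summits.QuantumFields.BalabanUV.Beta.GAN24.FineReadoutSum

/-!
# `BalabanUV.Beta.GAN24.FineReadoutGradient` — binder row G-an2-4 / (CONV-C), S-slot located remainder «E3Shape», route «S3-fibre²»
# (gan24-p1 `SKELETON-S3.md` v0.3–0.5 §7 (PC-2)∕§8 (I-L4) «… and the curl gain»; node E3A5 of `E3A-READOUT.md` §2(f); filed under the owner-assigned name `FineReadoutGradient`, RULINGS-4 l.4423):
# ONE LATTICE CURL ON THE MINIMISER LEG GAINS EXACTLY ONE `1/N` — the alias-side form (U2″) that the product symbol of S3-L4 consumes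

NOT IN PRINT; OUR PROOF ATTEMPT (of the road; THIS file is [folklore] bookkeeping on top of E3A2∕E3A3: the forward-difference symbol `∂̂_ν(k_m)` of each alias is
`O((1 + |srep m|)/N)` (folding `repZ = srep + N·shiftZ`, `|sin t| ≤ |t|`), so the curl raises King's exponent by ONE (`α ∈ {0, −1}`, still `< 1`) and contributes ONE
more `1/N`).  HONEST FRAMING (cell contract, verbatim): «discharging `BetaPertH` makes Bałaban's UV stability UNCONDITIONAL — a real constructive-QFT result; it
is NOT the continuum limit and NOT the Clay problem.»  HONEST DEPENDENCY (verbatim): «continuum YM on T⁴ ⇐ BetaPertH ∧ nine spine estimates (0/9 proved); BetaPertH ⇐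
(D1) ∧ (D4) ∧ CAP+tail; G-an2-4 gates asym, D1 and NE2/3/4.»  (U1)+A are HYPOTHESES; no cited fact, no wall binder, no `def … : Prop`; discharges NOTHING of
(hS, hSall) / «E3Shape»; NOT `BetaPertH`, NOT continuum, NOT Clay.  A SECOND curl is NOT available this way (King's sum at `α = 1` diverges; RESULTS.md (P3)).

## What is proved (generic `d`, `D = d+1`; strip `|Re p_i| ≤ π`, `|Im p_i| ≤ η`, `0 ≤ η ≤ 1/4`, `(3D/2+2)η ≤ 1/2`; `det F_N(p) ≠ 0`; radii `0 < r m`, `0 < r₀`)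
* §1 `abs_sin_half_kfine_le`: `|sin(kfine N q m i / 2)| ≤ (|q_i| + 2π|srep m i|)/(2N)`; `norm_dAl_le_fold`: `‖∂̂_ν(k_m)‖ ≤ (π + 2η + 2π·Fsup m)/N`;
  `norm_dAl_le_Fsup` (`m ≠ 0`: `≤ 15·Fsup m/N`), `norm_dAl_zero_le` (`m = 0`: `≤ (π + 1)/N`).
* §2 `norm_dAl_mul_Asol_border_le` (`m ≠ 0`): `‖∂̂_ν(k_m)·Asol…κ‖ ≤ 15·K_D·N²·(Φ/F + Cc/F²)·Π wfold` (`K_D = √12^D√6(1+8D)`) — one power of `F` LESS in the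
  denominator and one power of `N` LESS than E3A2: `pointWeight 0` and `pointWeight (−1)`.
* §3 **`norm_sum_ampA_dAl_pw_le`** — (U2″), THE CURLED MINIMISER COLUMN IN THE FIBRE:
  `‖Σ_m ampA p v m κ · ∂̂_ν(k_m) · pw (k_m) (repZ z)‖ ≤ e^{(d+1)η} · A · (N^{d+2})⁻¹ · N⁻¹ · (π + 1 + 15·K_D·(r₀²·C₀ + r₀³·C₋₁))`, `C₀ = (3π)·3^D·aliasConst D 0`,
  `C₋₁ = (3π)²·3^D·aliasConst D (−1)` — for the column `v = F_N(p)⁻¹ e_{(Q,l)}`; uniform in `N`, `p`, `κ`, `l`, `z`, `ν`.  (This alias sum IS the Bloch symbol of the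
  forward difference `wH(x + e_ν) − wH(x)`: `pw k_m (repZ z + e_ν) = e^{i k_{m,ν}}·pw k_m (repZ z)` and the box wrap `repZ(z + e_ν) = repZ z + e_ν − N e_ν` costs the
  `m`-INDEPENDENT phase `e^{−i p_ν}`; the position-space packaging is E3A4's with `fineM/N` — not repeated here.)
Unit `b2b-balaban-gan24-formalise-leaf-16` (G-an2-4 formalisation swarm, leaf prover 16, gen 8; records — idle-seat engine), 2026-08-20.
-/

noncomputable section

open Complex Finset Matrix
open scoped BigOperators Real Matrix.Norms.L2Operator
open Literature.Probability.LatticeModels (TorusSite)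
open Literature.MathematicalPhysics.QuantumFieldTheory.LatticeForm (repZ)
open Literature.MathematicalPhysics.QuantumFieldTheory.Balaban1983to89
open Literature.MathematicalPhysics.QuantumFieldTheory.Balaban1983to89.Beta
open Literature.MathematicalPhysics.QuantumFieldTheory.King1986 (aliasConst)
open B4Strip (reVec)
open BlochFibreMatrix (Idx stencil pieceMatrix)
open FibreInverseDecay (trigPolySymbol)
open Summit.QuantumFields.BalabanUV.Beta.GAN24.FibreSymbols (pw)
open Summit.QuantumFields.BalabanUV.Beta.GAN24.FibreBlockSolve (Asol)
open Summit.QuantumFields.BalabanUV.Beta.GAN24.FibreDFT (kFine)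
open Summit.QuantumFields.BalabanUV.Beta.GAN24.FibreDFTDictionary (ampA ampμ)
open Summit.QuantumFields.BalabanUV.Beta.GAN24.AliasWeights (kfine)
open Summit.QuantumFields.BalabanUV.Beta.GAN24.AliasObjects (chiAl sbAl dAl dbAl LAl)
open Summit.QuantumFields.BalabanUV.Beta.GAN24.AliasReindex (srep shiftZ repZ_eq_srep_add)
open Summit.QuantumFields.BalabanUV.Beta.GAN24.ArrowOperator (arrowMat aliasArrow pack)
open Summit.QuantumFields.BalabanUV.Beta.GAN24.ArrowScaling (scaledArrow)
open Summit.QuantumFields.BalabanUV.Beta.GAN24.StripAliasBounds (norm_dAl_le)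
open Summit.QuantumFields.BalabanUV.Beta.GAN24.CombesThomasFibre (fibInv)
open Summit.QuantumFields.BalabanUV.Beta.GAN24.AliasPointSum (pointWeight pointWeight_nonneg sum_pointWeight_srep_le)
open Summit.QuantumFields.BalabanUV.Beta.GAN24.FineReadoutAlias (wfold Fsup wfold_nonneg one_le_Fsup lapR_pos half_lapR_le_norm_LAl norm_Asol_border_le)
open Summit.QuantumFields.BalabanUV.Beta.GAN24.FineReadoutApriori (column_apriori)
open Summit.QuantumFields.BalabanUV.Beta.GAN24.FineReadoutSum (norm_pw_repZ_le ampA_eq_Asol pointWeight_neg_one_eq)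

namespace Summit.QuantumFields.BalabanUV.Beta.GAN24.FineReadoutGradient

variable {d N : ℕ} [NeZero N] {p : Fin (d + 1) → ℂ} {η : ℝ}

/-! ## §1 The forward-difference symbol of an alias is `O((1 + |srep m|)/N)` -/

/-- [folklore] FOLDING: `|sin(kfine N q m i / 2)| ≤ (|q_i| + 2π|srep m i|)/(2N)` — the nonnegative representative `val = srep + N·shiftZ` shifts the half-angle
by `π·shiftZ`, which `|sin|` does not see; then `|sin t| ≤ |t|`. -/
theorem abs_sin_half_kfine_le (q : Fin (d + 1) → ℝ) (m : TorusSite (d + 1) N) (i : Fin (d + 1)) :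
    |Real.sin (kfine N q m i / 2)| ≤ (|q i| + 2 * π * |((srep m i : ℤ) : ℝ)|) / (2 * N) := by
  have hN : (0 : ℝ) < N := by exact_mod_cast Nat.pos_of_ne_zero (NeZero.ne N)
  -- val = srep + N·shiftZ
  have hval : (((m i).val : ℕ) : ℝ) = ((srep m i : ℤ) : ℝ) + (N : ℝ) * ((shiftZ m i : ℤ) : ℝ) := by
    have h := repZ_eq_srep_add m i
    have h' : (repZ m i : ℤ) = ((m i).val : ℤ) := rfl
    rw [h'] at h
    exact_mod_cast h
  set a : ℝ := (q i + 2 * π * ((srep m i : ℤ) : ℝ)) / (2 * N) with ha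
  have hk : kfine N q m i / 2 = a + ((shiftZ m i : ℤ) : ℝ) * π := by
    unfold kfine; rw [hval, ha]; field_simp; ring
  -- shiftZ ∈ {0, 1}
  have hs : shiftZ m i = 0 ∨ shiftZ m i = 1 := by
    unfold shiftZ; split_ifs
    · exact Or.inl rfl
    · exact Or.inr rfl
  have habs : |Real.sin (kfine N q m i / 2)| = |Real.sin a| := by
    rw [hk]
    rcases hs with h0 | h1
    · rw [h0]; simp
    · rw [h1]; simp [Real.sin_add_pi]
  rw [habs]
  refine (Real.abs_sin_le_abs).trans ?_
  rw [ha, abs_div, abs_of_pos (by positivity : (0 : ℝ) < 2 * N)]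
  apply div_le_div_of_nonneg_right _ (by positivity)
  calc |q i + 2 * π * ((srep m i : ℤ) : ℝ)| ≤ |q i| + |2 * π * ((srep m i : ℤ) : ℝ)| := abs_add_le _ _
    _ = |q i| + 2 * π * |((srep m i : ℤ) : ℝ)| := by rw [abs_mul, abs_of_pos (by positivity : (0 : ℝ) < 2 * π)]

omit [NeZero N] in
/-- [folklore] Every coordinate of the symmetric representative is bounded by its sup norm `Fsup m`. -/
theorem abs_srep_le_Fsup (m : TorusSite (d + 1) N) (i : Fin (d + 1)) : |((srep m i : ℤ) : ℝ)| ≤ Fsup m := by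
  have h := norm_le_pi_norm (fun j => ((srep m j : ℤ) : ℝ)) i
  rw [Real.norm_eq_abs] at h
  exact h

/-- [folklore] **THE CURL SYMBOL ON THE STRIP**: `‖∂̂_ν(k_m)‖ ≤ (π + 2η + 2π·Fsup m)/N` (`|Re p_i| ≤ π`, `|Im p_i| ≤ η ≤ 1`). -/
theorem norm_dAl_le_fold (hre : ∀ i, |(p i).re| ≤ π) (him : ∀ i, |(p i).im| ≤ η) (hη1 : η ≤ 1) (m : TorusSite (d + 1) N) (ν : Fin (d + 1)) :
    ‖dAl N p m ν‖ ≤ (π + 2 * η + 2 * π * Fsup m) / N := by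
  have hN : (0 : ℝ) < N := by exact_mod_cast Nat.pos_of_ne_zero (NeZero.ne N)
  have h1 := norm_dAl_le him hη1 m ν
  have h2 := abs_sin_half_kfine_le (reVec p) m ν
  have h3 := abs_srep_le_Fsup m ν
  have hq : |reVec p ν| ≤ π := hre ν
  have : 2 * |Real.sin (kfine N (reVec p) m ν / 2)| ≤ (π + 2 * π * Fsup m) / N := by
    calc 2 * |Real.sin (kfine N (reVec p) m ν / 2)| ≤ 2 * ((|reVec p ν| + 2 * π * |((srep m ν : ℤ) : ℝ)|) / (2 * N)) := by linarith
      _ = (|reVec p ν| + 2 * π * |((srep m ν : ℤ) : ℝ)|) / N := by ring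
      _ ≤ (π + 2 * π * Fsup m) / N := by
          apply div_le_div_of_nonneg_right _ hN.le
          nlinarith [Real.pi_pos]
  calc ‖dAl N p m ν‖ ≤ 2 * |Real.sin (kfine N (reVec p) m ν / 2)| + 2 * (η / N) := h1
    _ ≤ (π + 2 * π * Fsup m) / N + 2 * (η / N) := by linarith
    _ = (π + 2 * η + 2 * π * Fsup m) / N := by ring

/-- [folklore] Off the zero alias (`Fsup m ≥ 1`, `η ≤ 1/2`): `‖∂̂_ν(k_m)‖ ≤ 15·Fsup m/N`. -/
theorem norm_dAl_le_Fsup (hre : ∀ i, |(p i).re| ≤ π) (him : ∀ i, |(p i).im| ≤ η) (hη2 : η ≤ 1 / 2) {m : TorusSite (d + 1) N} (hm : m ≠ 0)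
    (ν : Fin (d + 1)) : ‖dAl N p m ν‖ ≤ 15 * Fsup m / N := by
  have hN : (0 : ℝ) < N := by exact_mod_cast Nat.pos_of_ne_zero (NeZero.ne N)
  have hF := one_le_Fsup hm
  refine (norm_dAl_le_fold hre him (by linarith) m ν).trans (div_le_div_of_nonneg_right ?_ hN.le)
  nlinarith [Real.pi_lt_four, Real.pi_pos, mul_le_mul_of_nonneg_left hF (by positivity : (0:ℝ) ≤ π + 1)]

/-- [folklore] On the zero alias (`η ≤ 1/2`): `‖∂̂_ν(k_0)‖ ≤ (π + 1)/N`. -/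
theorem norm_dAl_zero_le (hre : ∀ i, |(p i).re| ≤ π) (him : ∀ i, |(p i).im| ≤ η) (hη2 : η ≤ 1 / 2) (ν : Fin (d + 1)) :
    ‖dAl N p (0 : TorusSite (d + 1) N) ν‖ ≤ (π + 1) / N := by
  have hN : (0 : ℝ) < N := by exact_mod_cast Nat.pos_of_ne_zero (NeZero.ne N)
  have hF0 : Fsup (0 : TorusSite (d + 1) N) = 0 := by
    unfold Fsup
    have : (fun i : Fin (d + 1) => ((srep (0 : TorusSite (d + 1) N) i : ℤ) : ℝ)) = 0 := by
      funext i; simp [srep]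
    rw [this, norm_zero]
  have h := norm_dAl_le_fold hre him (by linarith) (0 : TorusSite (d + 1) N) ν
  rw [hF0] at h
  refine h.trans (div_le_div_of_nonneg_right (by linarith) hN.le)

/-! ## §2 The curled border-fed block solution: one power of `F` and one power of `N` less -/

/-- [folklore] **ONE CURL ON THE LEG, PER ALIAS** (`m ≠ 0`): `‖∂̂_ν(k_m) · Asol…κ‖ ≤ 15·K_D·N²·(Φ/F + Cc/F²)·Π wfold`. -/
theorem norm_dAl_mul_Asol_border_le (hre : ∀ i, |(p i).re| ≤ π) (him : ∀ i, |(p i).im| ≤ η) (hη : 0 ≤ η) (hη4 : η ≤ 1 / 4)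
    (hηD : (3 * (d + 1 : ℕ) / 2 + 2) * η ≤ 1 / 2) {m : TorusSite (d + 1) N} (hm : m ≠ 0) {φ : Fin (d + 1) → ℂ} {c : ℂ} {Φ Cc : ℝ}
    (hΦ : ∀ l, ‖φ l‖ ≤ Φ) (hCc : ‖c‖ ≤ Cc) (κ ν : Fin (d + 1)) :
    ‖dAl N p m ν * Asol (dAl N p m) (dbAl N p m) (fun l => chiAl N p m * sbAl N p m l * φ l) (LAl N p m) (chiAl N p m * c) κ‖
      ≤ 15 * (Real.sqrt 12 ^ (d + 1) * (Real.sqrt 6 * (1 + 8 * (d + 1 : ℕ)))) * (N : ℝ) ^ 2 * (Φ / Fsup m + Cc / Fsup m ^ 2) * ∏ i, wfold m i := by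
  have hN : (0 : ℝ) < N := by exact_mod_cast Nat.pos_of_ne_zero (NeZero.ne N)
  have hF : 0 < Fsup m := lt_of_lt_of_le one_pos (one_le_Fsup hm)
  have hΦ0 : 0 ≤ Φ := (norm_nonneg _).trans (hΦ κ)
  have hCc0 : 0 ≤ Cc := (norm_nonneg _).trans hCc
  have hW : 0 ≤ ∏ i, wfold m i := Finset.prod_nonneg fun i _ => wfold_nonneg m i
  have h1 := norm_dAl_le_Fsup hre him (by linarith) hm ν
  have h2 := norm_Asol_border_le (D := d + 1) hre him hη hη4 hηD hm hΦ hCc κ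
  set K := Real.sqrt 12 ^ (d + 1) * (Real.sqrt 6 * (1 + 8 * (d + 1 : ℕ))) with hK
  have hK0 : 0 ≤ K := by positivity
  rw [norm_mul]
  calc ‖dAl N p m ν‖ * ‖Asol (dAl N p m) (dbAl N p m) (fun l => chiAl N p m * sbAl N p m l * φ l) (LAl N p m) (chiAl N p m * c) κ‖
      ≤ (15 * Fsup m / N) * (K * (N : ℝ) ^ 3 * (Φ / Fsup m ^ 2 + Cc / Fsup m ^ 3) * ∏ i, wfold m i) :=
        mul_le_mul h1 h2 (norm_nonneg _) (by positivity)
    _ = 15 * K * (N : ℝ) ^ 2 * (Φ / Fsup m + Cc / Fsup m ^ 2) * ∏ i, wfold m i := by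
        field_simp

/-- [folklore] `(Fsup m)⁻¹ · Π wfold = pointWeight 0 (srep m)` for `m ≠ 0`. -/
theorem pointWeight_zero_eq {m : TorusSite (d + 1) N} (hm : m ≠ 0) :
    1 / Fsup m * ∏ i, wfold m i = pointWeight 0 (srep m) := by
  have hF : 0 < Fsup m := lt_of_lt_of_le one_pos (one_le_Fsup hm)
  unfold pointWeight wfold Fsup AliasPointSum.realVec
  rw [show ((0 : ℝ) - 1) = -((1 : ℕ) : ℝ) by norm_num, Real.rpow_neg (norm_nonneg _), Real.rpow_natCast, pow_one, one_div]

/-! ## §3 (U2″): the curled minimiser column in the fibre -/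

/-- [folklore] **(U2″) — ONE CURL GAINS EXACTLY ONE `1/N`, UNIFORMLY**: for the minimiser column `v = F_N(p)⁻¹ e_{(Q,l)}` under (U1)+A,
`‖Σ_m ampA p v m κ · ∂̂_ν(k_m) · pw (k_m) (repZ z)‖ ≤ e^{(d+1)η}·A·(N^{d+2})⁻¹·N⁻¹·(π + 1 + 15·K_D·(r₀²·C₀ + r₀³·C₋₁))`. -/
theorem norm_sum_ampA_dAl_pw_le (hre : ∀ i, |(p i).re| ≤ π) (him : ∀ i, |(p i).im| ≤ η) (hη : 0 ≤ η) (hη4 : η ≤ 1 / 4)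
    (hηD : (3 * (d + 1 : ℕ) / 2 + 2) * η ≤ 1 / 2)
    (hdet : (trigPolySymbol (stencil (d + 1)) (pieceMatrix (N := N)) p).det ≠ 0)
    {r : TorusSite (d + 1) N → ℝ} (hr : ∀ m, 0 < r m) {r0 : ℝ} (hr0 : 0 < r0) {A : ℝ} (hA0 : 0 ≤ A)
    (hU : IsUnit (arrowMat (scaledArrow N r r0 p))) (hA : ‖(arrowMat (scaledArrow N r r0 p))⁻¹‖ ≤ A)
    (l κ ν : Fin (d + 1)) (z : TorusSite (d + 1) N) :
    ‖∑ m : TorusSite (d + 1) N,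
        ampA p (fun i => fibInv N i (Sum.inr (Sum.inr l)) p) m κ * dAl N p m ν * pw (kFine p m) (repZ z)‖
      ≤ Real.exp ((d + 1) * η) * A * ((N : ℝ) ^ (d + 1 + 1))⁻¹ * (N : ℝ)⁻¹ *
          (π + 1 + 15 * (Real.sqrt 12 ^ (d + 1) * (Real.sqrt 6 * (1 + 8 * (d + 1 : ℕ)))) *
            (r0 ^ 2 * ((3 * π) ^ (1 - (0 : ℝ)) * (3 : ℝ) ^ (d + 1) * aliasConst (d + 1) 0)
              + r0 ^ 3 * ((3 * π) ^ (1 - (-1 : ℝ)) * (3 : ℝ) ^ (d + 1) * aliasConst (d + 1) (-1)))) := by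
  classical
  set v : Idx (d + 1) N → ℂ := fun i => fibInv N i (Sum.inr (Sum.inr l)) p with hv
  set B : ℝ := A * ((N : ℝ) ^ (d + 1 + 1))⁻¹ with hB
  set K : ℝ := Real.sqrt 12 ^ (d + 1) * (Real.sqrt 6 * (1 + 8 * (d + 1 : ℕ))) with hK
  set C0 : ℝ := (3 * π) ^ (1 - (0 : ℝ)) * (3 : ℝ) ^ (d + 1) * aliasConst (d + 1) 0 with hC0
  set C1 : ℝ := (3 * π) ^ (1 - (-1 : ℝ)) * (3 : ℝ) ^ (d + 1) * aliasConst (d + 1) (-1) with hC1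
  set E : ℝ := Real.exp ((d + 1) * η) with hE
  have hN : (0 : ℝ) < N := by exact_mod_cast Nat.pos_of_ne_zero (NeZero.ne N)
  have hB0 : 0 ≤ B := by positivity
  have hK0 : 0 ≤ K := by positivity
  have hE0 : 0 ≤ E := (Real.exp_pos _).le
  obtain ⟨c, hx, hAmp, hφ, hc⟩ := column_apriori hr hr0 p hA0 hdet hU hA l
  set Φ : ℝ := r0 ^ 2 / (N : ℝ) ^ 3 * A * ((N : ℝ) ^ (d + 1 + 1))⁻¹ with hΦ
  set Cc : ℝ := r0 ^ 3 / (N : ℝ) ^ 3 * A * ((N : ℝ) ^ (d + 1 + 1))⁻¹ with hCc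
  have hΦ' : ∀ κ', ‖v (Sum.inr (Sum.inr κ'))‖ ≤ Φ := fun κ' => hφ κ'
  -- zero alias
  have hterm0 : ‖ampA p v 0 κ * dAl N p (0 : TorusSite (d + 1) N) ν * pw (kFine p (0 : TorusSite (d + 1) N)) (repZ z)‖ ≤ E * (B * ((π + 1) / N)) := by
    rw [norm_mul, norm_mul]
    have h0 := hAmp 0 κ
    have hd := norm_dAl_zero_le (N := N) hre him (by linarith) ν
    have hp := norm_pw_repZ_le him (0 : TorusSite (d + 1) N) z
    calc ‖ampA p v 0 κ‖ * ‖dAl N p 0 ν‖ * ‖pw (kFine p 0) (repZ z)‖ ≤ (B * ((π + 1) / N)) * E :=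
          mul_le_mul (mul_le_mul h0 hd (norm_nonneg _) hB0) hp (norm_nonneg _) (by positivity)
      _ = E * (B * ((π + 1) / N)) := mul_comm _ _
  -- nonzero aliases
  have hterm : ∀ m : TorusSite (d + 1) N, m ≠ 0 →
      ‖ampA p v m κ * dAl N p m ν * pw (kFine p m) (repZ z)‖
        ≤ E * (B * (N : ℝ)⁻¹ * (15 * K) * (r0 ^ 2 * pointWeight 0 (srep m) + r0 ^ 3 * pointWeight (-1) (srep m))) := by
    intro m hm
    have hLm : FibreSymbols.lapSym (kFine p m) ≠ 0 := by
      have hpos := lapR_pos (N := N) (p := p) hre hm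
      have hhalf := half_lapR_le_norm_LAl (N := N) hre him hη hηD hm
      intro h0
      have : ‖LAl N p m‖ = 0 := by rw [show LAl N p m = FibreSymbols.lapSym (kFine p m) from rfl, h0, norm_zero]
      linarith
    have hF : 0 < Fsup m := lt_of_lt_of_le one_pos (one_le_Fsup hm)
    have hcurl := norm_dAl_mul_Asol_border_le hre him hη hη4 hηD hm (φ := fun κ' => v (Sum.inr (Sum.inr κ'))) (c := c) hΦ' hc κ ν
    rw [← ampA_eq_Asol hx m hLm, ← hK] at hcurl
    have hre' : 15 * K * (N : ℝ) ^ 2 * (Φ / Fsup m + Cc / Fsup m ^ 2) * ∏ i, wfold m i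
        = B * (N : ℝ)⁻¹ * (15 * K) * (r0 ^ 2 * pointWeight 0 (srep m) + r0 ^ 3 * pointWeight (-1) (srep m)) := by
      rw [← pointWeight_zero_eq hm, ← pointWeight_neg_one_eq hm, hΦ, hCc, hB]
      field_simp
    rw [hre'] at hcurl
    rw [norm_mul, show ampA p v m κ * dAl N p m ν = dAl N p m ν * ampA p v m κ from mul_comm _ _]
    have h1 := AliasPointSum.pointWeight_nonneg (0 : ℝ) (srep m)
    have h2 := AliasPointSum.pointWeight_nonneg (-1 : ℝ) (srep m)
    calc ‖dAl N p m ν * ampA p v m κ‖ * ‖pw (kFine p m) (repZ z)‖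
        ≤ (B * (N : ℝ)⁻¹ * (15 * K) * (r0 ^ 2 * pointWeight 0 (srep m) + r0 ^ 3 * pointWeight (-1) (srep m))) * E :=
          mul_le_mul hcurl (norm_pw_repZ_le him m z) (norm_nonneg _) (by positivity)
      _ = _ := mul_comm _ _
  -- split and sum
  have hS0 := sum_pointWeight_srep_le (D := d + 1) (N := N) (Nat.succ_pos d) (α := 0) (by norm_num)
  have hS1 := sum_pointWeight_srep_le (D := d + 1) (N := N) (Nat.succ_pos d) (α := -1) (by norm_num)
  have hsplit : ‖∑ m : TorusSite (d + 1) N, ampA p v m κ * dAl N p m ν * pw (kFine p m) (repZ z)‖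
      ≤ E * (B * ((π + 1) / N)) + ∑ m ∈ (Finset.univ : Finset (TorusSite (d + 1) N)).filter (fun m => m ≠ 0),
          E * (B * (N : ℝ)⁻¹ * (15 * K) * (r0 ^ 2 * pointWeight 0 (srep m) + r0 ^ 3 * pointWeight (-1) (srep m))) := by
    refine (norm_sum_le _ _).trans ?_
    rw [← Finset.add_sum_erase _ _ (Finset.mem_univ (0 : TorusSite (d + 1) N))]
    refine add_le_add hterm0 ?_
    have hset : (Finset.univ : Finset (TorusSite (d + 1) N)).erase 0 = Finset.univ.filter (fun m => m ≠ 0) := by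
      ext m; simp [Finset.mem_erase]
    rw [hset]
    exact Finset.sum_le_sum fun m hm => hterm m (Finset.mem_filter.1 hm).2
  have hsum : ∑ m ∈ (Finset.univ : Finset (TorusSite (d + 1) N)).filter (fun m => m ≠ 0),
      E * (B * (N : ℝ)⁻¹ * (15 * K) * (r0 ^ 2 * pointWeight 0 (srep m) + r0 ^ 3 * pointWeight (-1) (srep m)))
      ≤ E * (B * (N : ℝ)⁻¹ * (15 * K) * (r0 ^ 2 * C0 + r0 ^ 3 * C1)) := by
    rw [← Finset.mul_sum, ← Finset.mul_sum, Finset.sum_add_distrib, ← Finset.mul_sum, ← Finset.mul_sum]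
    apply mul_le_mul_of_nonneg_left _ hE0
    apply mul_le_mul_of_nonneg_left _ (by positivity)
    exact add_le_add (mul_le_mul_of_nonneg_left hS0 (by positivity)) (mul_le_mul_of_nonneg_left hS1 (by positivity))
  calc _ ≤ E * (B * ((π + 1) / N)) + E * (B * (N : ℝ)⁻¹ * (15 * K) * (r0 ^ 2 * C0 + r0 ^ 3 * C1)) := hsplit.trans (add_le_add le_rfl hsum)
    _ = E * A * ((N : ℝ) ^ (d + 1 + 1))⁻¹ * (N : ℝ)⁻¹ * (π + 1 + 15 * K * (r0 ^ 2 * C0 + r0 ^ 3 * C1)) := by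
        rw [hB]; field_simp

end Summit.QuantumFields.BalabanUV.Beta.GAN24.FineReadoutGradient

end
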